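import Literature.MathematicalPhysics.QuantumFieldTheory.ConformalBootstrap3D.MeanFieldEdgeAB
import Literature.MathematicalPhysics.QuantumFieldTheory.ConformalBootstrap3D.MeanFieldSources
import Mathlib.Tactic
import HarnessLib

/-!
# The mixed mean-field identities at the level of Hogervorst–Rychkov coefficient arrays (unequal dimensions)

`(a,b)` version of `MeanFieldSources`: assembling `MeanFieldCoefficientsAB` (the coefficients `P_{n,ℓ}(p,q)` and
their twist recursion), `CasimirPairStencilAB` (the `(a,b)` Casimir pair), `MeanFieldFormalExpansionAB`
(closure relation, uniqueness engine, the `u^s` source) and `MeanFieldEdgeAB` (the leading-twist edges), this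
file proves the two FORMAL MIXED MEAN-FIELD IDENTITIES of two decoupled generalised free fields `φ`, `χ` of
dimensions `p, q > 1/2` (`s = (p+q)/2`, frame `2s`):

  `Σ_{n,ℓ} (-1)^ℓ P_{n,ℓ}(p,q)/λ_ℓ · [g^{(a,-a)}_{2s+2n+ℓ,ℓ}] = δ`       (`blockSumAB_mftI_eq_delta`, `a = (q-p)/2`),
  `Σ_{n,ℓ} P_{n,ℓ}(p,q)/λ_ℓ · [g^{(a,a)}_{2s+2n+ℓ,ℓ}]        = gg(p)`   (`blockSumAB_mftII_eq_ggArr`, `a = (p-q)/2`),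

the coefficient forms of the conformal block decompositions `u^s = Σ (-1)^ℓ P_{n,ℓ}(p,q) g^{Δ_σε,Δ_σε}_{p+q+2n+ℓ,ℓ}`
(the ordering `⟨φχφχ⟩`, typed block family `gmm`, `Δ_σε = p - q`, `(a,b) = (-Δ₁₂/2, Δ₃₄/2) = ((q-p)/2,(p-q)/2)`)
and `u^s v^{-p} = Σ P_{n,ℓ}(p,q) g^{-Δ_σε,Δ_σε}_{p+q+2n+ℓ,ℓ}` (the reflection-positive ordering `⟨χφφχ⟩`, family
`gpm`, `(a,b) = ((p-q)/2,(p-q)/2)`) with the Fitzpatrick–Kaplan coefficients [cite: FitzpatrickKaplan2012, §2.2]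
(originally [cite: HeemskerkPenedonesPolchinskiSully2009, §2]); the analytic identities on `(0,1)²` follow in
`MeanFieldDecompositionAB`. New ingredient here: the source array of `(u/v)^p` — unchanged, `ggArr p` (the
`𝒫`-array of `(z z̄)^s (1-z)^{-p}(1-z̄)^{-p}` does not depend on the frame `s`) — is in the `(a,a)` closure
relation with `ggArr (p+1)` with the constant `μ(p,q)` (`closureRelAB_ggArr`: ONE rational identity
`ggVal_closure_identityAB` in `p, q, j, k`, verified symbolically before formalisation, pub-ising3d-lit-g10
`code/ab_identities.py` (B)). The proof (closure under the `(a,b)` Casimir pair [cite: DolanOsborn2011, §4.2] plus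
leading-twist edges) is elementary and finite; at `q = p` everything reduces to `MeanFieldSources`.
-/

namespace Literature.MathematicalPhysics.QuantumFieldTheory.ConformalBootstrap3D

open Finset

/-! ### The `(u/v)^p` source in the `(a,a)` closure relation -/

set_option maxHeartbeats 4000000 in
set_option maxRecDepth 8000 in
/-- **The closure identity for the `(u/v)^p` source under the `(a,a)` stencil**, generic entry: with
`s = (p+q)/2`, `a = (p-q)/2`, `M = j + 2k + 2`,
`ℓ_s(2s+M,j) gg(p;k+1,j+k+1) + clUpAB gg(p;k+1,j+k) + clDnAB gg(p;k,j+k+1) + clTwoAB gg(p;k,j+k) = μ(p,q) gg(p+1;k,j+k)`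
— one rational identity in `p, q, j, k` after factoring out `(p-1/2)_k (p)_{j+k} / (k! (3/2)_{j+k})`. [folklore] -/
theorem ggVal_closure_identityAB {p q : ℝ} (hp : 1 / 2 < p) (j k : ℕ) :
    clDiag ((p + q) / 2) (2 * ((p + q) / 2) + ((j : ℝ) + 2 * k + 2)) j * ggVal p (k + 1) (j + k + 1) +
      clUpAB ((p - q) / 2) ((p - q) / 2) ((p + q) / 2) (2 * ((p + q) / 2) + ((j : ℝ) + 2 * k + 1)) ((j : ℝ) - 1) *
          ggVal p (k + 1) (j + k) +
      clDnAB ((p - q) / 2) ((p - q) / 2) ((p + q) / 2) (2 * ((p + q) / 2) + ((j : ℝ) + 2 * k + 1)) ((j : ℝ) + 1) *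
          ggVal p k (j + k + 1) +
      clTwoAB ((p - q) / 2) ((p - q) / 2) (2 * ((p + q) / 2) + ((j : ℝ) + 2 * k)) j * ggVal p k (j + k) =
    mftMuAB p q * ggVal (p + 1) k (j + k) := by
  unfold ggVal
  -- reduce all Pochhammer symbols to the four atoms `a = (p-1/2)_k`, `b = (p)_{j+k}`, `f = k!`, `g = (3/2)_{j+k}`
  have ea : poch (p - 1 / 2) (k + 1) = poch (p - 1 / 2) k * (p - 1 / 2 + k) := poch_succ _ _
  have eb : poch p (j + k + 1) = poch p (j + k) * (p + ↑(j + k)) := poch_succ _ _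
  have ef : ((k + 1).factorial : ℝ) = ((k : ℝ) + 1) * (k.factorial : ℝ) := by
    rw [Nat.factorial_succ]; push_cast; ring
  have eg : poch (3 / 2) (j + k + 1) = poch (3 / 2) (j + k) * (3 / 2 + ↑(j + k)) := poch_succ _ _
  have ea' : poch (p + 1 - 1 / 2) k = poch (p - 1 / 2) k * (p - 1 / 2 + k) / (p - 1 / 2) := by
    rw [eq_div_iff (by linarith : (p - 1 / 2) ≠ 0)]
    have h := poch_succ_left (p - 1 / 2) k
    rw [poch_succ] at h
    rw [show p + 1 - 1 / 2 = p - 1 / 2 + 1 by ring]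
    linarith [h]
  have eb' : poch (p + 1) (j + k) = poch p (j + k) * (p + ↑(j + k)) / p := by
    rw [eq_div_iff (by linarith : p ≠ 0)]
    have h := poch_succ_left p (j + k)
    rw [poch_succ] at h
    linarith [h]
  rw [ea, eb, ef, eg, ea', eb']
  set a := poch (p - 1 / 2) k
  set b := poch p (j + k)
  set f := (k.factorial : ℝ)
  set g := poch (3 / 2) (j + k)
  have hf : f ≠ 0 := by positivity
  have hg : g ≠ 0 := poch_ne_zero (by norm_num) _
  have hp0 : p ≠ 0 := by intro h; linarith
  have hp1 : (p - 1 / 2) ≠ 0 := by intro h; linarith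
  have hp1' : (-1 + p * 2) ≠ 0 := by intro h; linarith
  have hp1'' : (2 * p - 1) ≠ 0 := by intro h; linarith
  have hp2 : (p * 2 - 1) ≠ 0 := by intro h; linarith
  have hk1 : ((k : ℝ) + 1) ≠ 0 := by positivity
  have hjk : (3 / 2 + ((j + k : ℕ) : ℝ)) ≠ 0 := by positivity
  have hj1 : (2 * (j : ℝ) + 1) ≠ 0 := by positivity
  have hj3 : (2 * ((j : ℝ) + 1) + 1) ≠ 0 := by positivity
  have hj2 : (2 * ((j : ℝ) - 1) + 1) ≠ 0 := by
    intro h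
    have h' : (2 * j : ℤ) = 1 := by
      have : (2 : ℝ) * j = 1 := by linarith
      exact_mod_cast this
    omega
  unfold clDiag clUpAB clDnAB clTwoAB mftMuAB
  push_cast
  field_simp
  ring

/-- **`(u/v)^p` is in the `(a,a)` closure relation with `(u/v)^{p+1}`**: with `s = (p+q)/2`, `a = (p-q)/2`,
`𝕃^{(a,a)}_s gg(p) = μ(p,q) S² gg(p+1)` (`p > 1/2`). [cite: DolanOsborn2011, §4.2] -/
theorem closureRelAB_ggArr {p q : ℝ} (hp : 1 / 2 < p) :
    ClosureRelAB ((p - q) / 2) ((p - q) / 2) ((p + q) / 2) (mftMuAB p q) (ggArr p) (ggArr (p + 1)) := by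
  intro M j
  set s := (p + q) / 2 with hs
  set a := (p - q) / 2 with ha
  by_cases hsupp : 0 ≤ j ∧ j ≤ M ∧ Even (M - j)
  swap
  · -- off the support everything vanishes
    have hx : ∀ n i : ℤ, ¬ InRangeZ 0 n i → ggArr p n i = 0 := fun n i h =>
      ggArr_eq_zero_of_not_supp p (by rwa [inRangeZ_zero_iff] at h)
    rw [opLAB_eq_zero_of_not_inRangeZ a a s (2 * s) 0 hx (by rwa [inRangeZ_zero_iff]),
      ggArr_eq_zero_of_not_supp (p + 1) (fun h => hsupp ⟨h.1, by omega, by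
        obtain ⟨r, hr⟩ := h.2.2; exact ⟨r + 1, by omega⟩⟩), mul_zero]
  obtain ⟨hj, hjM, ⟨r, hr⟩⟩ := hsupp
  lift j to ℕ using hj
  have hr0 : 0 ≤ r := by omega
  lift r to ℕ using hr0
  simp only [opLAB]
  cases r with
  | zero =>
    -- the edge `M = j`: `clDiag` and `clUpAB` vanish on the leading twist, the other entries are off-support
    have hM : M = j := by omega
    subst hM
    rw [clDiag_leading, clUpAB_leading,
      ggArr_eq_zero_of_not_supp p (M := (j : ℤ) - 1) (j := (j : ℤ) + 1) (by omega),
      ggArr_eq_zero_of_not_supp p (M := (j : ℤ) - 2) (j := (j : ℤ)) (by omega),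
      ggArr_eq_zero_of_not_supp (p + 1) (M := (j : ℤ) - 2) (j := (j : ℤ)) (by omega)]
    ring
  | succ k =>
    have hM : M = j + 2 * k + 2 := by omega
    -- the five entries
    have t1 : ggArr p M j = ggVal p (k + 1) (j + k + 1) :=
      ggArr_of_supp p (k + 1) (j + k + 1) (by push_cast; omega) (by push_cast; omega) (by omega)
    have t2 : clUpAB a a s (2 * s + ((M - 1 : ℤ) : ℝ)) (((j : ℤ) - 1 : ℤ) : ℝ) * ggArr p (M - 1) (j - 1) =
        clUpAB a a s (2 * s + ((M - 1 : ℤ) : ℝ)) (((j : ℤ) - 1 : ℤ) : ℝ) * ggVal p (k + 1) (j + k) := by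
      rcases Nat.eq_zero_or_pos j with hj0 | hjpos
      · subst hj0
        rw [show (((0 : ℕ) : ℤ) - 1 : ℤ) = -1 by simp, Int.cast_neg, Int.cast_one, clUpAB_neg_one]
        ring
      · rw [ggArr_of_supp p (k + 1) (j + k) (by push_cast; omega) (by push_cast; omega) (by omega)]
    have t3 : ggArr p (M - 1) (j + 1) = ggVal p k (j + k + 1) :=
      ggArr_of_supp p k (j + k + 1) (by push_cast; omega) (by push_cast; omega) (by omega)
    have t4 : ggArr p (M - 2) j = ggVal p k (j + k) :=
      ggArr_of_supp p k (j + k) (by push_cast; omega) (by push_cast; omega) (by omega)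
    have t5 : ggArr (p + 1) (M - 2) j = ggVal (p + 1) k (j + k) :=
      ggArr_of_supp (p + 1) k (j + k) (by push_cast; omega) (by push_cast; omega) (by omega)
    rw [t2, t1, t3, t4, t5]
    have eM : ((M : ℤ) : ℝ) = (j : ℝ) + 2 * k + 2 := by rw [hM]; push_cast; ring
    have eM1 : ((M - 1 : ℤ) : ℝ) = (j : ℝ) + 2 * k + 1 := by rw [hM]; push_cast; ring
    have eM2 : ((M - 2 : ℤ) : ℝ) = (j : ℝ) + 2 * k := by rw [hM]; push_cast; ring
    have ej : (((j : ℕ) : ℤ) : ℝ) = (j : ℝ) := by push_cast; ring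
    have ejm : ((((j : ℕ) : ℤ) - 1 : ℤ) : ℝ) = (j : ℝ) - 1 := by push_cast; ring
    have ejp : ((((j : ℕ) : ℤ) + 1 : ℤ) : ℝ) = (j : ℝ) + 1 := by push_cast; ring
    rw [eM, eM1, eM2, ejm, ejp, ej]
    exact ggVal_closure_identityAB (q := q) hp j k

/-! ### The formal mixed mean-field identities -/

/-- **Formal mixed mean-field identity, `u^s` family (`⟨σεσε⟩` ordering)**: in the frame `2s = p + q`
(`p, q > 1/2`), with `(a,b) = ((q-p)/2, (p-q)/2)`,
`Σ_{n,ℓ} (-1)^ℓ P_{n,ℓ}(p,q)/λ_ℓ · [g^{(a,b)}_{2s+2n+ℓ,ℓ}] = δ_{(0,0)}` — the coefficient form of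
`u^s = Σ_{n,ℓ} (-1)^ℓ P_{n,ℓ}(p,q) g^{Δ_σε,Δ_σε}_{p+q+2n+ℓ,ℓ}`, `Δ_σε = p - q`. [cite: FitzpatrickKaplan2012, §2.2] -/
theorem blockSumAB_mftI_eq_delta {p q : ℝ} (hp : 1 / 2 < p) (hq : 1 / 2 < q) :
    blockSumAB ((q - p) / 2) ((p - q) / 2) ((p + q) / 2)
      (fun n ℓ => (-1 : ℝ) ^ ℓ * mftCoeffAB p q n ℓ / legendreLam ℓ) = deltaArr := by
  have hs : 1 / 2 < (p + q) / 2 := by linarith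
  set X : ℕ → ℤ → ℤ → ℝ := fun i =>
    blockSumAB ((q - p) / 2) ((p - q) / 2) ((p + q) / 2 + i)
      (fun n ℓ => (-1 : ℝ) ^ ℓ * mftCoeffAB (p + i) (q + i) n ℓ / legendreLam ℓ) with hX
  have hpi : ∀ i : ℕ, 1 / 2 < p + i := fun i => by
    have : (0 : ℝ) ≤ i := Nat.cast_nonneg i; linarith
  have hqi : ∀ i : ℕ, 1 / 2 < q + i := fun i => by
    have : (0 : ℝ) ≤ i := Nat.cast_nonneg i; linarith
  have key := eq_of_closureRelAB hs ((q - p) / 2) ((p - q) / 2) (fun i : ℕ => mftMuAB (p + i) (q + i)) X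
    (fun _ => deltaArr)
    (fun i => by
      have h := closureRelAB_blockSum_mft (hpi i) (hqi i) ((q - p) / 2) ((p - q) / 2) (fun ℓ => (-1 : ℝ) ^ ℓ)
      simp only [hX, Nat.cast_succ]
      rw [show (p + q) / 2 + ((i : ℝ) + 1) = (p + i + (q + i)) / 2 + 1 by ring,
        show (p + q) / 2 + (i : ℝ) = (p + i + (q + i)) / 2 by ring,
        show p + ((i : ℝ) + 1) = p + i + 1 by ring, show q + ((i : ℝ) + 1) = q + i + 1 by ring]
      exact h)
    (fun i => by
      have h := closureRelAB_delta_mft (p + i) (q + i)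
      rwa [show (q + i - (p + i)) / 2 = (q - p) / 2 by ring, show (p + i - (q + i)) / 2 = (p - q) / 2 by ring,
        show (p + i + (q + i)) / 2 = (p + q) / 2 + (i : ℝ) by ring] at h)
    (fun i M j h => blockSumAB_eq_zero_of_not_supp _ _ _ _ h)
    (fun i M j h => deltaArr_eq_zero_of_not_supp h)
    (fun i M => by
      simp only [hX]
      rcases lt_or_ge M 0 with hneg | hnn
      · rw [blockSumAB_eq_zero_of_not_supp _ _ _ _ (fun h => absurd h.1 (by omega)),
          deltaArr_eq_zero_of_not_supp (fun h => absurd h.1 (by omega))]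
      · lift M to ℕ using hnn
        have h := blockSumAB_mftI_edge (hpi i) (hqi i) M
        rw [show (q + i - (p + i)) / 2 = (q - p) / 2 by ring, show (p + i - (q + i)) / 2 = (p - q) / 2 by ring,
          show (p + i + (q + i)) / 2 = (p + q) / 2 + (i : ℝ) by ring] at h
        rw [h]
        simp [deltaArr])
  simpa [hX] using key 0

/-- **Formal mixed mean-field identity, `(u/v)`-type family (`⟨εσσε⟩` ordering)**: in the frame `2s = p + q`
(`p, q > 1/2`), with `(a,b) = ((p-q)/2, (p-q)/2)`,
`Σ_{n,ℓ} P_{n,ℓ}(p,q)/λ_ℓ · [g^{(a,b)}_{2s+2n+ℓ,ℓ}] = gg(p)` — the coefficient form of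
`u^s v^{-p} = Σ_{n,ℓ} P_{n,ℓ}(p,q) g^{-Δ_σε,Δ_σε}_{p+q+2n+ℓ,ℓ}`. [cite: FitzpatrickKaplan2012, §2.2] -/
theorem blockSumAB_mftII_eq_ggArr {p q : ℝ} (hp : 1 / 2 < p) (hq : 1 / 2 < q) :
    blockSumAB ((p - q) / 2) ((p - q) / 2) ((p + q) / 2) (fun n ℓ => mftCoeffAB p q n ℓ / legendreLam ℓ) =
      ggArr p := by
  have hs : 1 / 2 < (p + q) / 2 := by linarith
  set X : ℕ → ℤ → ℤ → ℝ := fun i =>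
    blockSumAB ((p - q) / 2) ((p - q) / 2) ((p + q) / 2 + i)
      (fun n ℓ => (1 : ℝ) * mftCoeffAB (p + i) (q + i) n ℓ / legendreLam ℓ) with hX
  have hpi : ∀ i : ℕ, 1 / 2 < p + i := fun i => by
    have : (0 : ℝ) ≤ i := Nat.cast_nonneg i; linarith
  have hqi : ∀ i : ℕ, 1 / 2 < q + i := fun i => by
    have : (0 : ℝ) ≤ i := Nat.cast_nonneg i; linarith
  have key := eq_of_closureRelAB hs ((p - q) / 2) ((p - q) / 2) (fun i : ℕ => mftMuAB (p + i) (q + i)) X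
    (fun i => ggArr (p + i))
    (fun i => by
      have h := closureRelAB_blockSum_mft (hpi i) (hqi i) ((p - q) / 2) ((p - q) / 2) (fun _ => (1 : ℝ))
      simp only [hX, Nat.cast_succ]
      rw [show (p + q) / 2 + ((i : ℝ) + 1) = (p + i + (q + i)) / 2 + 1 by ring,
        show (p + q) / 2 + (i : ℝ) = (p + i + (q + i)) / 2 by ring,
        show p + ((i : ℝ) + 1) = p + i + 1 by ring, show q + ((i : ℝ) + 1) = q + i + 1 by ring]
      exact h)
    (fun i => by
      have h := closureRelAB_ggArr (q := q + i) (hpi i)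
      rw [show (p + i - (q + i)) / 2 = (p - q) / 2 by ring,
        show (p + i + (q + i)) / 2 = (p + q) / 2 + (i : ℝ) by ring] at h
      simp only [Nat.cast_succ]
      rw [show p + ((i : ℝ) + 1) = p + i + 1 by ring]
      exact h)
    (fun i M j h => blockSumAB_eq_zero_of_not_supp _ _ _ _ h)
    (fun i M j h => ggArr_eq_zero_of_not_supp _ h)
    (fun i M => by
      simp only [hX]
      rcases lt_or_ge M 0 with hneg | hnn
      · rw [blockSumAB_eq_zero_of_not_supp _ _ _ _ (fun h => absurd h.1 (by omega)),
          ggArr_eq_zero_of_not_supp _ (fun h => absurd h.1 (by omega))]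
      · lift M to ℕ using hnn
        have h := blockSumAB_mftII_edge (hpi i) (hqi i) M
        rw [show (p + i - (q + i)) / 2 = (p - q) / 2 by ring,
          show (p + i + (q + i)) / 2 = (p + q) / 2 + (i : ℝ) by ring] at h
        rw [h, ggArr_edge])
  have h0 := key 0
  simp only [hX, Nat.cast_zero, add_zero, one_mul] at h0
  exact h0

end Literature.MathematicalPhysics.QuantumFieldTheory.ConformalBootstrap3D
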